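import Summits.ValiantsHypothesis.ValiantsHypothesis.Theorems.SymPencilPerFourInnerRankPureGramNuSide

/-!
# Route `SymPencil` — inner rank of the `2 | 2` row split of `per_4`, the pure Gram problem P1:
# the assembly of STEPS (1)–(3) with STEPS (4)–(5) as explicit hypotheses
# (`--supports` stmt-ValiantsHypothesis-5674 `SdcSuperquadratic`; (8,8) column; rung currency only)

**Theorem** (`false_of_allX_of_lines`).  Let `Σ_r c_r t_r((a,b),(y₂,y₃))² = per (a; b; y₂; y₃)` be a PURE
design with at most eleven squares (`|ι| ≤ 11`, characteristic `0`).  ASSUME the line step of the P1 blueprint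
for the three sign classes: `Hppp / Hppm / Hpmm :` every pure design on `ι` whose `ν`-Gram table
`⟨n_bk, n_b'k'⟩` is LITERALLY the class table (scale `τ = 1`, the `hN` format of `…PureGramLinePPPKernel`;
for `+++` this is `…false_of_allX_of_nGram_c0_ppp hι` of val-lit-p8's chain) is contradictory.  Then `False`.
Proof: `…PureGramNuSide.nu_side_trichotomy` / `mu_side_trichotomy` (STEP 2) — the certified exits feed
`…PureGramCount.false_of_allX_of_kernel_three_three` (STEP 1), the zero exits
`…false_of_allX_of_nGram_zero` (STEP 3; the `μ`-side through the transposed design), and a line exit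
`⟨n_bk,n_b'k'⟩ = τ·(compact table)` is RESCALED (`rescale_pure`: `(c, ν + μ) ↦ (c/τ, ν + τ μ)` is again a
pure design on `ι` with the same `ν`-vectors) to scale `1` and translated to the literal table
(`bridge_ppp/ppm/pmm`).  So P1 (pure `per_4`-designs need twelve squares) ⟸ the three line lemmas;
the `μ`-line needs nothing extra (transposition).  Honest framing: a CONDITIONAL assembly inside one cell
of the size tables; `(8,8,10)`, `(8,8,11)` stay open; the window `27 ≤ sdc(per_4) ≤ 29`, the crux
`SdcSuperquadratic` and `VP ≠ VNP` are untouched.  No definitions, no named facts. [folklore]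
-/

noncomputable section

-- single-conjunct layout: Sub = Summit, duplicated namespace component intended
set_option linter.dupNamespace false

namespace Summit.ValiantsHypothesis.ValiantsHypothesis.Theorems.SymPencilPerFourInnerRankPureGramNuAssembly

open Matrix Finset
open Summit.ValiantsHypothesis.ValiantsHypothesis.Theorems.SymPencilPerFourInnerRankRows
open Summit.ValiantsHypothesis.ValiantsHypothesis.Theorems.SymPencilPerFourInnerRankTenFamily
open Summit.ValiantsHypothesis.ValiantsHypothesis.Theorems.SymPencilPerFourInnerRankPureGramCount
open Summit.ValiantsHypothesis.ValiantsHypothesis.Theorems.SymPencilPerFourInnerRankPureGramNuSide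

variable {K : Type*} [Field K] [CharZero K] {ι : Type*} [Fintype ι]

omit [CharZero K] [Fintype ι] in
/-- Purity on general vectors: `t((a,0),(y,0)) = 0` and `t((0,b),(0,y)) = 0`. [folklore] -/
theorem allX_general (t : ι → (((Fin 4 → K) × (Fin 4 → K)) →ₗ[K] ((Fin 4 → K) × (Fin 4 → K)) →ₗ[K] K))
    (hX : (∀ k : Fin 4, (∀ (a : Fin 4 → K) r, t r (a, 0) (Pi.single k 1, 0) = 0) ∧
        (∀ (b : Fin 4 → K) r, t r (0, b) (0, Pi.single k 1) = 0))) :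
    (∀ (a y : Fin 4 → K) r, t r (a, 0) (y, 0) = 0) ∧ (∀ (b y : Fin 4 → K) r, t r (0, b) (0, y) = 0) := by
  have hy : ∀ y : Fin 4 → K, ((y, (0 : Fin 4 → K)) : (Fin 4 → K) × (Fin 4 → K)) =
      y 0 • (Pi.single 0 1, 0) + y 1 • (Pi.single 1 1, 0) + y 2 • (Pi.single 2 1, 0) +
        y 3 • (Pi.single 3 1, 0) := fun y => by
    ext i <;> fin_cases i <;> simp
  have hy' : ∀ y : Fin 4 → K, (((0 : Fin 4 → K), y) : (Fin 4 → K) × (Fin 4 → K)) =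
      y 0 • (0, Pi.single 0 1) + y 1 • (0, Pi.single 1 1) + y 2 • (0, Pi.single 2 1) +
        y 3 • (0, Pi.single 3 1) := fun y => by
    ext i <;> fin_cases i <;> simp
  refine ⟨fun a y r => ?_, fun b y r => ?_⟩
  · rw [hy y]
    simp only [map_add, map_smul, smul_eq_mul, (hX _).1, mul_zero, add_zero]
  · rw [hy' y]
    simp only [map_add, map_smul, smul_eq_mul, (hX _).2, mul_zero, add_zero]

/-- **Rescaling a pure design.**  For `τ ≠ 0`, `(c, ν + μ) ↦ (c/τ, ν + τ μ)` is again a pure design on the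
same index type, with the same `ν`-vectors `t((0,b),(y,0))` (so its `ν`-Gram is `1/τ` times the old one).
[folklore] -/
theorem rescale_pure (c : ι → K) (t : ι → (((Fin 4 → K) × (Fin 4 → K)) →ₗ[K] ((Fin 4 → K) × (Fin 4 → K)) →ₗ[K] K))
    (hJ : (∀ a b y₂ y₃ : Fin 4 → K,
        ∑ r, c r * (t r (a, b) (y₂, y₃)) ^ 2 = (Matrix.of ![a, b, y₂, y₃]).permanent))
    (hX : (∀ k : Fin 4, (∀ (a : Fin 4 → K) r, t r (a, 0) (Pi.single k 1, 0) = 0) ∧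
        (∀ (b : Fin 4 → K) r, t r (0, b) (0, Pi.single k 1) = 0))) (τ : K) (hτ : τ ≠ 0) :
    ∃ (c' : ι → K) (t' : ι → (((Fin 4 → K) × (Fin 4 → K)) →ₗ[K] ((Fin 4 → K) × (Fin 4 → K)) →ₗ[K] K)),
      (∀ a b y₂ y₃ : Fin 4 → K,
        ∑ r, c' r * (t' r (a, b) (y₂, y₃)) ^ 2 = (Matrix.of ![a, b, y₂, y₃]).permanent) ∧
      (∀ k : Fin 4, (∀ (a : Fin 4 → K) r, t' r (a, 0) (Pi.single k 1, 0) = 0) ∧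
        (∀ (b : Fin 4 → K) r, t' r (0, b) (0, Pi.single k 1) = 0)) ∧
      (∀ (b y : Fin 4 → K) r, t' r (0, b) (y, 0) = t r (0, b) (y, 0)) ∧ (∀ r, c' r = c r / τ) := by
  obtain ⟨hXa, hXb⟩ := allX_general t hX
  -- the projections onto the `ν`- and `μ`-arguments
  let Pν : ((Fin 4 → K) × (Fin 4 → K)) →ₗ[K] ((Fin 4 → K) × (Fin 4 → K)) :=
    { toFun := fun u => (0, u.2)
      map_add' := fun u v => by simp
      map_smul' := fun s u => by simp }
  let Qν : ((Fin 4 → K) × (Fin 4 → K)) →ₗ[K] ((Fin 4 → K) × (Fin 4 → K)) :=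
    { toFun := fun y => (y.1, 0)
      map_add' := fun u v => by simp
      map_smul' := fun s u => by simp }
  let Pμ : ((Fin 4 → K) × (Fin 4 → K)) →ₗ[K] ((Fin 4 → K) × (Fin 4 → K)) :=
    { toFun := fun u => (u.1, 0)
      map_add' := fun u v => by simp
      map_smul' := fun s u => by simp }
  let Qμ : ((Fin 4 → K) × (Fin 4 → K)) →ₗ[K] ((Fin 4 → K) × (Fin 4 → K)) :=
    { toFun := fun y => (0, y.2)
      map_add' := fun u v => by simp
      map_smul' := fun s u => by simp }
  let t' : ι → (((Fin 4 → K) × (Fin 4 → K)) →ₗ[K] ((Fin 4 → K) × (Fin 4 → K)) →ₗ[K] K) :=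
    fun r => ((t r).comp Pν).compl₂ Qν + τ • ((t r).comp Pμ).compl₂ Qμ
  have ht' : ∀ r (a b y₂ y₃ : Fin 4 → K),
      t' r (a, b) (y₂, y₃) = t r (0, b) (y₂, 0) + τ * t r (a, 0) (0, y₃) := fun r a b y₂ y₃ => rfl
  have h00 : (((0 : Fin 4 → K), (0 : Fin 4 → K)) : (Fin 4 → K) × (Fin 4 → K)) = 0 := rfl
  have hz1 : ∀ r (y : (Fin 4 → K) × (Fin 4 → K)), t r 0 y = 0 := fun r y => by rw [map_zero]; rfl
  have hz2 : ∀ r (u : (Fin 4 → K) × (Fin 4 → K)), t r u 0 = 0 := fun r u => map_zero _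
  refine ⟨fun r => c r / τ, t', ?_, ?_, ?_, fun r => rfl⟩
  · intro a b y₂ y₃
    have e1 := hJ 0 b y₂ 0
    rw [per_zero_row₀] at e1
    have e2 := hJ a 0 0 y₃
    rw [per_zero_row₂] at e2
    have e3 := hJ a b y₂ y₃
    have hdec : ∀ r, t r (a, b) (y₂, y₃) = t r (0, b) (y₂, 0) + t r (a, 0) (0, y₃) := fun r => by
      have hab : t r (a, b) = t r (a, 0) + t r (0, b) := by
        rw [← map_add]; simp
      have hy : ((y₂, y₃) : (Fin 4 → K) × (Fin 4 → K)) = (y₂, 0) + (0, y₃) := by simp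
      rw [hab, LinearMap.add_apply, hy, map_add, map_add, hXa, hXb]
      ring
    simp_rw [hdec] at e3
    simp_rw [ht']
    rw [← e3]
    have ex1 : ∑ r, c r / τ * (t r (0, b) (y₂, 0) + τ * t r (a, 0) (0, y₃)) ^ 2 =
        τ⁻¹ * ∑ r, c r * (t r (0, b) (y₂, 0)) ^ 2 +
        2 * ∑ r, c r * t r (0, b) (y₂, 0) * t r (a, 0) (0, y₃) +
        τ * ∑ r, c r * (t r (a, 0) (0, y₃)) ^ 2 := by
      rw [Finset.mul_sum, Finset.mul_sum, Finset.mul_sum, ← Finset.sum_add_distrib,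
        ← Finset.sum_add_distrib]
      refine Finset.sum_congr rfl fun r _ => ?_
      field_simp
      ring
    have ex2 : ∑ r, c r * (t r (0, b) (y₂, 0) + t r (a, 0) (0, y₃)) ^ 2 =
        ∑ r, c r * (t r (0, b) (y₂, 0)) ^ 2 +
        2 * ∑ r, c r * t r (0, b) (y₂, 0) * t r (a, 0) (0, y₃) +
        ∑ r, c r * (t r (a, 0) (0, y₃)) ^ 2 := by
      rw [Finset.mul_sum, ← Finset.sum_add_distrib, ← Finset.sum_add_distrib]
      exact Finset.sum_congr rfl fun r _ => by ring
    rw [ex1, ex2, e1, e2]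
    ring
  · intro k
    refine ⟨fun a r => ?_, fun b r => ?_⟩
    · rw [ht', h00, hz1, hz2, mul_zero, add_zero]
    · rw [ht', h00, hz2, hz1, mul_zero, add_zero]
  · intro b y r
    rw [ht', h00, hz1, mul_zero, add_zero]

omit [CharZero K] in
/-- The compact line table of class `ppp` equals the literal `256`-entry table (the `hN` format of
`…PureGramLinePPPKernel`, generated by the same rule `ε(b,b') ε(k,k') c₀^σ[π b b'][π k k']`). [folklore] -/
theorem bridge_ppp : ∀ b k b' k' : Fin 4,
    (![![(0 : K), 1, 1, 1], ![-1, 0, 1, 1], ![-1, -1, 0, 1], ![-1, -1, -1, 0]] b b') *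
    (![![(0 : K), 1, 1, 1], ![-1, 0, 1, 1], ![-1, -1, 0, 1], ![-1, -1, -1, 0]] k k') *
    ((!![0, 0, 0, 0, 0, 1; 0, 0, 0, 0, 1, 0; 0, 0, 0, 1, 0, 0; 0, 0, 1, 0, 0, 0; 0, 1, 0, 0, 0, 0;
          1, 0, 0, 0, 0, 0] : Matrix (Fin 6) (Fin 6) K)
      (![![(0 : Fin 6), 0, 1, 2], ![0, 0, 3, 4], ![1, 3, 0, 5], ![2, 4, 5, 0]] b b') (![![(0 : Fin 6), 0, 1, 2], ![0, 0, 3, 4], ![1, 3, 0, 5], ![2, 4, 5, 0]] k k')) =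
    (![![![![(0 : K), (0 : K), (0 : K), (0 : K)], ![(0 : K), (0 : K), (0 : K), (0 : K)], ![(0 : K), (0 : K), (0 : K), (0 : K)], ![(0 : K), (0 : K), (0 : K), (0 : K)]], ![![(0 : K), (0 : K), (0 : K), (0 : K)], ![(0 : K), (0 : K), (0 : K), (0 : K)], ![(0 : K), (0 : K), (0 : K), (1 : K)], ![(0 : K), (0 : K), (1 : K), (0 : K)]], ![![(0 : K), (0 : K), (0 : K), (0 : K)], ![(0 : K), (0 : K), (0 : K), (1 : K)], ![(0 : K), (0 : K), (0 : K), (0 : K)], ![(0 : K), (-1 : K), (0 : K), (0 : K)]], ![![(0 : K), (0 : K), (0 : K), (0 : K)], ![(0 : K), (0 : K), (-1 : K), (0 : K)], ![(0 : K), (-1 : K), (0 : K), (0 : K)], ![(0 : K), (0 : K), (0 : K), (0 : K)]]], ![![![(0 : K), (0 : K), (0 : K), (0 : K)], ![(0 : K), (0 : K), (0 : K), (0 : K)], ![(0 : K), (0 : K), (0 : K), (1 : K)], ![(0 : K), (0 : K), (1 : K), (0 : K)]], ![![(0 : K), (0 : K), (0 : K), (0 : K)], ![(0 : K), (0 : K),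 (0 : K), (0 : K)], ![(0 : K), (0 : K), (0 : K), (0 : K)], ![(0 : K), (0 : K), (0 : K), (0 : K)]], ![![(0 : K), (0 : K), (0 : K), (-1 : K)], ![(0 : K), (0 : K), (0 : K), (0 : K)], ![(0 : K), (0 : K), (0 : K), (0 : K)], ![(-1 : K), (0 : K), (0 : K), (0 : K)]], ![![(0 : K), (0 : K), (1 : K), (0 : K)], ![(0 : K), (0 : K), (0 : K), (0 : K)], ![(-1 : K), (0 : K), (0 : K), (0 : K)], ![(0 : K), (0 : K), (0 : K), (0 : K)]]], ![![![(0 : K), (0 : K), (0 : K), (0 : K)], ![(0 : K), (0 : K), (0 : K), (-1 : K)], ![(0 : K), (0 : K), (0 : K), (0 : K)], ![(0 : K), (1 : K), (0 : K), (0 : K)]], ![![(0 : K), (0 : K), (0 : K), (-1 : K)], ![(0 : K), (0 : K), (0 : K), (0 : K)], ![(0 : K), (0 : K), (0 : K), (0 : K)], ![(-1 : K), (0 : K), (0 : K), (0 : K)]], ![![(0 : K), (0 : K), (0 : K), (0 : K)], ![(0 : K), (0 : K), (0 : K), (0 : K)], ![(0 : K), (0 : K), (0 : K), (0 : K)], ![(0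 : K), (0 : K), (0 : K), (0 : K)]], ![![(0 : K), (1 : K), (0 : K), (0 : K)], ![(1 : K), (0 : K), (0 : K), (0 : K)], ![(0 : K), (0 : K), (0 : K), (0 : K)], ![(0 : K), (0 : K), (0 : K), (0 : K)]]], ![![![(0 : K), (0 : K), (0 : K), (0 : K)], ![(0 : K), (0 : K), (-1 : K), (0 : K)], ![(0 : K), (-1 : K), (0 : K), (0 : K)], ![(0 : K), (0 : K), (0 : K), (0 : K)]], ![![(0 : K), (0 : K), (-1 : K), (0 : K)], ![(0 : K), (0 : K), (0 : K), (0 : K)], ![(1 : K), (0 : K), (0 : K), (0 : K)], ![(0 : K), (0 : K), (0 : K), (0 : K)]], ![![(0 : K), (1 : K), (0 : K), (0 : K)], ![(1 : K), (0 : K), (0 : K), (0 : K)], ![(0 : K), (0 : K), (0 : K), (0 : K)], ![(0 : K), (0 : K), (0 : K), (0 : K)]], ![![(0 : K), (0 : K), (0 : K), (0 : K)], ![(0 : K), (0 : K), (0 : K), (0 : K)], ![(0 : K), (0 : K), (0 : K), (0 : K)], ![(0 : K), (0 : K), (0 : K), (0 : K)]]]] : Fin 4 → Fin 4 → Fin 4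 → Fin 4 → K) b k b' k' := by
  simp only [Fin.forall_fin_succ, IsEmpty.forall_iff, and_true, Matrix.cons_val_zero, Matrix.cons_val_succ,
    Matrix.of_apply, Matrix.cons_val]
  norm_num

omit [CharZero K] in
/-- The compact line table of class `ppm` equals the literal `256`-entry table (the `hN` format of
`…PureGramLinePPPKernel`, generated by the same rule `ε(b,b') ε(k,k') c₀^σ[π b b'][π k k']`). [folklore] -/
theorem bridge_ppm : ∀ b k b' k' : Fin 4,
    (![![(0 : K), 1, 1, 1], ![-1, 0, 1, 1], ![-1, -1, 0, 1], ![-1, -1, -1, 0]] b b') *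
    (![![(0 : K), 1, 1, 1], ![-1, 0, 1, 1], ![-1, -1, 0, 1], ![-1, -1, -1, 0]] k k') *
    ((!![0, 0, 0, 0, 0, 1; 0, 0, 0, 0, 1, 0; 0, 0, 0, -1, 0, 0; 0, 0, -1, 0, 0, 0; 0, 1, 0, 0, 0, 0;
          1, 0, 0, 0, 0, 0] : Matrix (Fin 6) (Fin 6) K)
      (![![(0 : Fin 6), 0, 1, 2], ![0, 0, 3, 4], ![1, 3, 0, 5], ![2, 4, 5, 0]] b b') (![![(0 : Fin 6), 0, 1, 2], ![0, 0, 3, 4], ![1, 3, 0, 5], ![2, 4, 5, 0]] k k')) =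
    (![![![![(0 : K), (0 : K), (0 : K), (0 : K)], ![(0 : K), (0 : K), (0 : K), (0 : K)], ![(0 : K), (0 : K), (0 : K), (0 : K)], ![(0 : K), (0 : K), (0 : K), (0 : K)]], ![![(0 : K), (0 : K), (0 : K), (0 : K)], ![(0 : K), (0 : K), (0 : K), (0 : K)], ![(0 : K), (0 : K), (0 : K), (1 : K)], ![(0 : K), (0 : K), (-1 : K), (0 : K)]], ![![(0 : K), (0 : K), (0 : K), (0 : K)], ![(0 : K), (0 : K), (0 : K), (1 : K)], ![(0 : K), (0 : K), (0 : K), (0 : K)], ![(0 : K), (1 : K), (0 : K), (0 : K)]], ![![(0 : K), (0 : K), (0 : K), (0 : K)], ![(0 : K), (0 : K), (-1 : K), (0 : K)], ![(0 : K), (-1 : K), (0 : K), (0 : K)], ![(0 : K), (0 : K), (0 : K), (0 : K)]]], ![![![(0 : K), (0 : K), (0 : K), (0 : K)], ![(0 : K), (0 : K), (0 : K), (0 : K)], ![(0 : K), (0 : K), (0 : K), (-1 : K)], ![(0 : K), (0 : K), (1 : K), (0 : K)]], ![![(0 : K), (0 : K), (0 : K), (0 : K)], ![(0 : K), (0 :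 K), (0 : K), (0 : K)], ![(0 : K), (0 : K), (0 : K), (0 : K)], ![(0 : K), (0 : K), (0 : K), (0 : K)]], ![![(0 : K), (0 : K), (0 : K), (-1 : K)], ![(0 : K), (0 : K), (0 : K), (0 : K)], ![(0 : K), (0 : K), (0 : K), (0 : K)], ![(-1 : K), (0 : K), (0 : K), (0 : K)]], ![![(0 : K), (0 : K), (1 : K), (0 : K)], ![(0 : K), (0 : K), (0 : K), (0 : K)], ![(1 : K), (0 : K), (0 : K), (0 : K)], ![(0 : K), (0 : K), (0 : K), (0 : K)]]], ![![![(0 : K), (0 : K), (0 : K), (0 : K)], ![(0 : K), (0 : K), (0 : K), (1 : K)], ![(0 : K), (0 : K), (0 : K), (0 : K)], ![(0 : K), (1 : K), (0 : K), (0 : K)]], ![![(0 : K), (0 : K), (0 : K), (-1 : K)], ![(0 : K), (0 : K), (0 : K), (0 : K)], ![(0 : K), (0 : K), (0 : K), (0 : K)], ![(-1 : K), (0 : K), (0 : K), (0 : K)]], ![![(0 : K), (0 : K), (0 : K), (0 : K)], ![(0 : K), (0 : K), (0 : K), (0 : K)], ![(0 : K), (0 : K), (0 : K), (0 : K)], ![(0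 : K), (0 : K), (0 : K), (0 : K)]], ![![(0 : K), (1 : K), (0 : K), (0 : K)], ![(-1 : K), (0 : K), (0 : K), (0 : K)], ![(0 : K), (0 : K), (0 : K), (0 : K)], ![(0 : K), (0 : K), (0 : K), (0 : K)]]], ![![![(0 : K), (0 : K), (0 : K), (0 : K)], ![(0 : K), (0 : K), (-1 : K), (0 : K)], ![(0 : K), (-1 : K), (0 : K), (0 : K)], ![(0 : K), (0 : K), (0 : K), (0 : K)]], ![![(0 : K), (0 : K), (1 : K), (0 : K)], ![(0 : K), (0 : K), (0 : K), (0 : K)], ![(1 : K), (0 : K), (0 : K), (0 : K)], ![(0 : K), (0 : K), (0 : K), (0 : K)]], ![![(0 : K), (-1 : K), (0 : K), (0 : K)], ![(1 : K), (0 : K), (0 : K), (0 : K)], ![(0 : K), (0 : K), (0 : K), (0 : K)], ![(0 : K), (0 : K), (0 : K), (0 : K)]], ![![(0 : K), (0 : K), (0 : K), (0 : K)], ![(0 : K), (0 : K), (0 : K), (0 : K)], ![(0 : K), (0 : K), (0 : K), (0 : K)], ![(0 : K), (0 : K), (0 : K), (0 : K)]]]] : Fin 4 → Fin 4 → Fin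 4 → Fin 4 → K) b k b' k' := by
  simp only [Fin.forall_fin_succ, IsEmpty.forall_iff, and_true, Matrix.cons_val_zero, Matrix.cons_val_succ,
    Matrix.of_apply, Matrix.cons_val]
  norm_num

omit [CharZero K] in
/-- The compact line table of class `pmm` equals the literal `256`-entry table (the `hN` format of
`…PureGramLinePPPKernel`, generated by the same rule `ε(b,b') ε(k,k') c₀^σ[π b b'][π k k']`). [folklore] -/
theorem bridge_pmm : ∀ b k b' k' : Fin 4,
    (![![(0 : K), 1, 1, 1], ![-1, 0, 1, 1], ![-1, -1, 0, 1], ![-1, -1, -1, 0]] b b') *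
    (![![(0 : K), 1, 1, 1], ![-1, 0, 1, 1], ![-1, -1, 0, 1], ![-1, -1, -1, 0]] k k') *
    ((!![0, 0, 0, 0, 0, 1; 0, 0, 0, 0, -1, 0; 0, 0, 0, -1, 0, 0; 0, 0, -1, 0, 0, 0; 0, -1, 0, 0, 0, 0;
          1, 0, 0, 0, 0, 0] : Matrix (Fin 6) (Fin 6) K)
      (![![(0 : Fin 6), 0, 1, 2], ![0, 0, 3, 4], ![1, 3, 0, 5], ![2, 4, 5, 0]] b b') (![![(0 : Fin 6), 0, 1, 2], ![0, 0, 3, 4], ![1, 3, 0, 5], ![2, 4, 5, 0]] k k')) =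
    (![![![![(0 : K), (0 : K), (0 : K), (0 : K)], ![(0 : K), (0 : K), (0 : K), (0 : K)], ![(0 : K), (0 : K), (0 : K), (0 : K)], ![(0 : K), (0 : K), (0 : K), (0 : K)]], ![![(0 : K), (0 : K), (0 : K), (0 : K)], ![(0 : K), (0 : K), (0 : K), (0 : K)], ![(0 : K), (0 : K), (0 : K), (-1 : K)], ![(0 : K), (0 : K), (-1 : K), (0 : K)]], ![![(0 : K), (0 : K), (0 : K), (0 : K)], ![(0 : K), (0 : K), (0 : K), (1 : K)], ![(0 : K), (0 : K), (0 : K), (0 : K)], ![(0 : K), (1 : K), (0 : K), (0 : K)]], ![![(0 : K), (0 : K), (0 : K), (0 : K)], ![(0 : K), (0 : K), (-1 : K), (0 : K)], ![(0 : K), (1 : K), (0 : K), (0 : K)], ![(0 : K), (0 : K), (0 : K), (0 : K)]]], ![![![(0 : K), (0 : K), (0 : K), (0 : K)], ![(0 : K), (0 : K), (0 : K), (0 : K)], ![(0 : K), (0 : K), (0 : K), (-1 : K)], ![(0 : K), (0 : K), (-1 : K), (0 : K)]], ![![(0 : K), (0 : K), (0 : K), (0 : K)], ![(0 : K), (0 :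 K), (0 : K), (0 : K)], ![(0 : K), (0 : K), (0 : K), (0 : K)], ![(0 : K), (0 : K), (0 : K), (0 : K)]], ![![(0 : K), (0 : K), (0 : K), (-1 : K)], ![(0 : K), (0 : K), (0 : K), (0 : K)], ![(0 : K), (0 : K), (0 : K), (0 : K)], ![(1 : K), (0 : K), (0 : K), (0 : K)]], ![![(0 : K), (0 : K), (1 : K), (0 : K)], ![(0 : K), (0 : K), (0 : K), (0 : K)], ![(1 : K), (0 : K), (0 : K), (0 : K)], ![(0 : K), (0 : K), (0 : K), (0 : K)]]], ![![![(0 : K), (0 : K), (0 : K), (0 : K)], ![(0 : K), (0 : K), (0 : K), (1 : K)], ![(0 : K), (0 : K), (0 : K), (0 : K)], ![(0 : K), (1 : K), (0 : K), (0 : K)]], ![![(0 : K), (0 : K), (0 : K), (1 : K)], ![(0 : K), (0 : K), (0 : K), (0 : K)], ![(0 : K), (0 : K), (0 : K), (0 : K)], ![(-1 : K), (0 : K), (0 : K), (0 : K)]], ![![(0 : K), (0 : K), (0 : K), (0 : K)], ![(0 : K), (0 : K), (0 : K), (0 : K)], ![(0 : K), (0 : K), (0 : K), (0 : K)], ![(0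 : K), (0 : K), (0 : K), (0 : K)]], ![![(0 : K), (-1 : K), (0 : K), (0 : K)], ![(-1 : K), (0 : K), (0 : K), (0 : K)], ![(0 : K), (0 : K), (0 : K), (0 : K)], ![(0 : K), (0 : K), (0 : K), (0 : K)]]], ![![![(0 : K), (0 : K), (0 : K), (0 : K)], ![(0 : K), (0 : K), (1 : K), (0 : K)], ![(0 : K), (-1 : K), (0 : K), (0 : K)], ![(0 : K), (0 : K), (0 : K), (0 : K)]], ![![(0 : K), (0 : K), (1 : K), (0 : K)], ![(0 : K), (0 : K), (0 : K), (0 : K)], ![(1 : K), (0 : K), (0 : K), (0 : K)], ![(0 : K), (0 : K), (0 : K), (0 : K)]], ![![(0 : K), (-1 : K), (0 : K), (0 : K)], ![(-1 : K), (0 : K), (0 : K), (0 : K)], ![(0 : K), (0 : K), (0 : K), (0 : K)], ![(0 : K), (0 : K), (0 : K), (0 : K)]], ![![(0 : K), (0 : K), (0 : K), (0 : K)], ![(0 : K), (0 : K), (0 : K), (0 : K)], ![(0 : K), (0 : K), (0 : K), (0 : K)], ![(0 : K), (0 : K), (0 : K), (0 : K)]]]] : Fin 4 → Fin 4 → Fin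 4 → Fin 4 → K) b k b' k' := by
  simp only [Fin.forall_fin_succ, IsEmpty.forall_iff, and_true, Matrix.cons_val_zero, Matrix.cons_val_succ,
    Matrix.of_apply, Matrix.cons_val]
  norm_num

/-- **P1 modulo the line step.**  A pure `per_4`-design with at most eleven squares is contradictory,
GIVEN the three class lemmas «a pure design on `ι` whose `ν`-Gram is literally the class table is
contradictory» (`Hppp` = `…false_of_allX_of_nGram_c0_ppp hι` of the `…PureGramLinePPP*` chain; the other two
classes likewise or by relabelling).  See the module docstring. [folklore] -/
theorem false_of_allX_of_lines [DecidableEq ι] (hι : Fintype.card ι ≤ 11) (c : ι → K) (t : ι → (((Fin 4 → K) × (Fin 4 → K)) →ₗ[K] ((Fin 4 → K) × (Fin 4 → K)) →ₗ[K] K))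
    (hJ : (∀ a b y₂ y₃ : Fin 4 → K,
        ∑ r, c r * (t r (a, b) (y₂, y₃)) ^ 2 = (Matrix.of ![a, b, y₂, y₃]).permanent))
    (hX : (∀ k : Fin 4, (∀ (a : Fin 4 → K) r, t r (a, 0) (Pi.single k 1, 0) = 0) ∧
        (∀ (b : Fin 4 → K) r, t r (0, b) (0, Pi.single k 1) = 0)))
    (Hppp : ∀ (c' : ι → K) (t' : ι → (((Fin 4 → K) × (Fin 4 → K)) →ₗ[K] ((Fin 4 → K) × (Fin 4 → K)) →ₗ[K] K)),
      (∀ a b y₂ y₃ : Fin 4 → K,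
        ∑ r, c' r * (t' r (a, b) (y₂, y₃)) ^ 2 = (Matrix.of ![a, b, y₂, y₃]).permanent) →
      (∀ k : Fin 4, (∀ (a : Fin 4 → K) r, t' r (a, 0) (Pi.single k 1, 0) = 0) ∧
        (∀ (b : Fin 4 → K) r, t' r (0, b) (0, Pi.single k 1) = 0)) →
      (∀ b k b' k' : Fin 4, ∑ r, c' r * t' r (0, Pi.single b 1) (Pi.single k 1, 0) *
        t' r (0, Pi.single b' 1) (Pi.single k' 1, 0) = (![![![![(0 : K), (0 : K), (0 : K), (0 : K)], ![(0 : K), (0 : K), (0 : K), (0 : K)], ![(0 : K), (0 : K), (0 : K), (0 : K)], ![(0 : K), (0 : K), (0 : K), (0 : K)]], ![![(0 : K), (0 : K), (0 : K), (0 : K)], ![(0 : K), (0 : K), (0 : K), (0 : K)], ![(0 : K), (0 : K), (0 : K), (1 : K)], ![(0 : K), (0 : K), (1 : K), (0 : K)]], ![![(0 : K), (0 : K), (0 : K), (0 : K)], ![(0 : K), (0 : K), (0 : K), (1 : K)], ![(0 : K), (0 : K), (0 : K), (0 : K)], ![(0 : K), (-1 : K), (0 : K), (0 : K)]], ![![(0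 : K), (0 : K), (0 : K), (0 : K)], ![(0 : K), (0 : K), (-1 : K), (0 : K)], ![(0 : K), (-1 : K), (0 : K), (0 : K)], ![(0 : K), (0 : K), (0 : K), (0 : K)]]], ![![![(0 : K), (0 : K), (0 : K), (0 : K)], ![(0 : K), (0 : K), (0 : K), (0 : K)], ![(0 : K), (0 : K), (0 : K), (1 : K)], ![(0 : K), (0 : K), (1 : K), (0 : K)]], ![![(0 : K), (0 : K), (0 : K), (0 : K)], ![(0 : K), (0 : K), (0 : K), (0 : K)], ![(0 : K), (0 : K), (0 : K), (0 : K)], ![(0 : K), (0 : K), (0 : K), (0 : K)]], ![![(0 : K), (0 : K), (0 : K), (-1 : K)], ![(0 : K), (0 : K), (0 : K), (0 : K)], ![(0 : K), (0 : K), (0 : K), (0 : K)], ![(-1 : K), (0 : K), (0 : K), (0 : K)]], ![![(0 : K), (0 : K), (1 : K), (0 : K)], ![(0 : K), (0 : K), (0 : K), (0 : K)], ![(-1 : K), (0 : K), (0 : K), (0 : K)], ![(0 : K), (0 : K), (0 : K), (0 : K)]]], ![![![(0 : K), (0 : K), (0 : K), (0 : K)], ![(0 : K), (0 : K), (0 :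 K), (-1 : K)], ![(0 : K), (0 : K), (0 : K), (0 : K)], ![(0 : K), (1 : K), (0 : K), (0 : K)]], ![![(0 : K), (0 : K), (0 : K), (-1 : K)], ![(0 : K), (0 : K), (0 : K), (0 : K)], ![(0 : K), (0 : K), (0 : K), (0 : K)], ![(-1 : K), (0 : K), (0 : K), (0 : K)]], ![![(0 : K), (0 : K), (0 : K), (0 : K)], ![(0 : K), (0 : K), (0 : K), (0 : K)], ![(0 : K), (0 : K), (0 : K), (0 : K)], ![(0 : K), (0 : K), (0 : K), (0 : K)]], ![![(0 : K), (1 : K), (0 : K), (0 : K)], ![(1 : K), (0 : K), (0 : K), (0 : K)], ![(0 : K), (0 : K), (0 : K), (0 : K)], ![(0 : K), (0 : K), (0 : K), (0 : K)]]], ![![![(0 : K), (0 : K), (0 : K), (0 : K)], ![(0 : K), (0 : K), (-1 : K), (0 : K)], ![(0 : K), (-1 : K), (0 : K), (0 : K)], ![(0 : K), (0 : K), (0 : K), (0 : K)]], ![![(0 : K), (0 : K), (-1 : K), (0 : K)], ![(0 : K), (0 : K), (0 : K), (0 : K)], ![(1 : K), (0 : K), (0 : K), (0 : K)], ![(0 :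 K), (0 : K), (0 : K), (0 : K)]], ![![(0 : K), (1 : K), (0 : K), (0 : K)], ![(1 : K), (0 : K), (0 : K), (0 : K)], ![(0 : K), (0 : K), (0 : K), (0 : K)], ![(0 : K), (0 : K), (0 : K), (0 : K)]], ![![(0 : K), (0 : K), (0 : K), (0 : K)], ![(0 : K), (0 : K), (0 : K), (0 : K)], ![(0 : K), (0 : K), (0 : K), (0 : K)], ![(0 : K), (0 : K), (0 : K), (0 : K)]]]] : Fin 4 → Fin 4 → Fin 4 → Fin 4 → K) b k b' k') → False)
    (Hppm : ∀ (c' : ι → K) (t' : ι → (((Fin 4 → K) × (Fin 4 → K)) →ₗ[K] ((Fin 4 → K) × (Fin 4 → K)) →ₗ[K] K)),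
      (∀ a b y₂ y₃ : Fin 4 → K,
        ∑ r, c' r * (t' r (a, b) (y₂, y₃)) ^ 2 = (Matrix.of ![a, b, y₂, y₃]).permanent) →
      (∀ k : Fin 4, (∀ (a : Fin 4 → K) r, t' r (a, 0) (Pi.single k 1, 0) = 0) ∧
        (∀ (b : Fin 4 → K) r, t' r (0, b) (0, Pi.single k 1) = 0)) →
      (∀ b k b' k' : Fin 4, ∑ r, c' r * t' r (0, Pi.single b 1) (Pi.single k 1, 0) *
        t' r (0, Pi.single b' 1) (Pi.single k' 1, 0) = (![![![![(0 : K), (0 : K), (0 : K), (0 : K)], ![(0 : K), (0 : K), (0 : K), (0 : K)], ![(0 : K), (0 : K), (0 : K), (0 : K)], ![(0 : K), (0 : K), (0 : K), (0 : K)]], ![![(0 : K), (0 : K), (0 : K), (0 : K)], ![(0 : K), (0 : K), (0 : K), (0 : K)], ![(0 : K), (0 : K), (0 : K), (1 : K)], ![(0 : K), (0 : K), (-1 : K), (0 : K)]], ![![(0 : K), (0 : K), (0 : K), (0 : K)], ![(0 : K), (0 : K), (0 : K), (1 : K)], ![(0 : K), (0 : K), (0 : K), (0 : K)], ![(0 :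 K), (1 : K), (0 : K), (0 : K)]], ![![(0 : K), (0 : K), (0 : K), (0 : K)], ![(0 : K), (0 : K), (-1 : K), (0 : K)], ![(0 : K), (-1 : K), (0 : K), (0 : K)], ![(0 : K), (0 : K), (0 : K), (0 : K)]]], ![![![(0 : K), (0 : K), (0 : K), (0 : K)], ![(0 : K), (0 : K), (0 : K), (0 : K)], ![(0 : K), (0 : K), (0 : K), (-1 : K)], ![(0 : K), (0 : K), (1 : K), (0 : K)]], ![![(0 : K), (0 : K), (0 : K), (0 : K)], ![(0 : K), (0 : K), (0 : K), (0 : K)], ![(0 : K), (0 : K), (0 : K), (0 : K)], ![(0 : K), (0 : K), (0 : K), (0 : K)]], ![![(0 : K), (0 : K), (0 : K), (-1 : K)], ![(0 : K), (0 : K), (0 : K), (0 : K)], ![(0 : K), (0 : K), (0 : K), (0 : K)], ![(-1 : K), (0 : K), (0 : K), (0 : K)]], ![![(0 : K), (0 : K), (1 : K), (0 : K)], ![(0 : K), (0 : K), (0 : K), (0 : K)], ![(1 : K), (0 : K), (0 : K), (0 : K)], ![(0 : K), (0 : K), (0 : K), (0 : K)]]], ![![![(0 : K), (0 : K), (0 :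 K), (0 : K)], ![(0 : K), (0 : K), (0 : K), (1 : K)], ![(0 : K), (0 : K), (0 : K), (0 : K)], ![(0 : K), (1 : K), (0 : K), (0 : K)]], ![![(0 : K), (0 : K), (0 : K), (-1 : K)], ![(0 : K), (0 : K), (0 : K), (0 : K)], ![(0 : K), (0 : K), (0 : K), (0 : K)], ![(-1 : K), (0 : K), (0 : K), (0 : K)]], ![![(0 : K), (0 : K), (0 : K), (0 : K)], ![(0 : K), (0 : K), (0 : K), (0 : K)], ![(0 : K), (0 : K), (0 : K), (0 : K)], ![(0 : K), (0 : K), (0 : K), (0 : K)]], ![![(0 : K), (1 : K), (0 : K), (0 : K)], ![(-1 : K), (0 : K), (0 : K), (0 : K)], ![(0 : K), (0 : K), (0 : K), (0 : K)], ![(0 : K), (0 : K), (0 : K), (0 : K)]]], ![![![(0 : K), (0 : K), (0 : K), (0 : K)], ![(0 : K), (0 : K), (-1 : K), (0 : K)], ![(0 : K), (-1 : K), (0 : K), (0 : K)], ![(0 : K), (0 : K), (0 : K), (0 : K)]], ![![(0 : K), (0 : K), (1 : K), (0 : K)], ![(0 : K), (0 : K), (0 : K), (0 : K)], ![(1 :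 K), (0 : K), (0 : K), (0 : K)], ![(0 : K), (0 : K), (0 : K), (0 : K)]], ![![(0 : K), (-1 : K), (0 : K), (0 : K)], ![(1 : K), (0 : K), (0 : K), (0 : K)], ![(0 : K), (0 : K), (0 : K), (0 : K)], ![(0 : K), (0 : K), (0 : K), (0 : K)]], ![![(0 : K), (0 : K), (0 : K), (0 : K)], ![(0 : K), (0 : K), (0 : K), (0 : K)], ![(0 : K), (0 : K), (0 : K), (0 : K)], ![(0 : K), (0 : K), (0 : K), (0 : K)]]]] : Fin 4 → Fin 4 → Fin 4 → Fin 4 → K) b k b' k') → False)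
    (Hpmm : ∀ (c' : ι → K) (t' : ι → (((Fin 4 → K) × (Fin 4 → K)) →ₗ[K] ((Fin 4 → K) × (Fin 4 → K)) →ₗ[K] K)),
      (∀ a b y₂ y₃ : Fin 4 → K,
        ∑ r, c' r * (t' r (a, b) (y₂, y₃)) ^ 2 = (Matrix.of ![a, b, y₂, y₃]).permanent) →
      (∀ k : Fin 4, (∀ (a : Fin 4 → K) r, t' r (a, 0) (Pi.single k 1, 0) = 0) ∧
        (∀ (b : Fin 4 → K) r, t' r (0, b) (0, Pi.single k 1) = 0)) →
      (∀ b k b' k' : Fin 4, ∑ r, c' r * t' r (0, Pi.single b 1) (Pi.single k 1, 0) *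
        t' r (0, Pi.single b' 1) (Pi.single k' 1, 0) = (![![![![(0 : K), (0 : K), (0 : K), (0 : K)], ![(0 : K), (0 : K), (0 : K), (0 : K)], ![(0 : K), (0 : K), (0 : K), (0 : K)], ![(0 : K), (0 : K), (0 : K), (0 : K)]], ![![(0 : K), (0 : K), (0 : K), (0 : K)], ![(0 : K), (0 : K), (0 : K), (0 : K)], ![(0 : K), (0 : K), (0 : K), (-1 : K)], ![(0 : K), (0 : K), (-1 : K), (0 : K)]], ![![(0 : K), (0 : K), (0 : K), (0 : K)], ![(0 : K), (0 : K), (0 : K), (1 : K)], ![(0 : K), (0 : K), (0 : K), (0 : K)], ![(0 : K), (1 : K), (0 : K), (0 : K)]], ![![(0 : K), (0 : K), (0 : K), (0 : K)], ![(0 : K), (0 : K), (-1 : K), (0 : K)], ![(0 : K), (1 : K), (0 : K), (0 : K)], ![(0 : K), (0 : K), (0 : K), (0 : K)]]], ![![![(0 : K), (0 : K), (0 : K), (0 : K)], ![(0 : K), (0 : K), (0 : K), (0 : K)], ![(0 : K), (0 : K), (0 : K), (-1 : K)], ![(0 : K), (0 : K), (-1 : K), (0 : K)]], ![![(0 : K),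 (0 : K), (0 : K), (0 : K)], ![(0 : K), (0 : K), (0 : K), (0 : K)], ![(0 : K), (0 : K), (0 : K), (0 : K)], ![(0 : K), (0 : K), (0 : K), (0 : K)]], ![![(0 : K), (0 : K), (0 : K), (-1 : K)], ![(0 : K), (0 : K), (0 : K), (0 : K)], ![(0 : K), (0 : K), (0 : K), (0 : K)], ![(1 : K), (0 : K), (0 : K), (0 : K)]], ![![(0 : K), (0 : K), (1 : K), (0 : K)], ![(0 : K), (0 : K), (0 : K), (0 : K)], ![(1 : K), (0 : K), (0 : K), (0 : K)], ![(0 : K), (0 : K), (0 : K), (0 : K)]]], ![![![(0 : K), (0 : K), (0 : K), (0 : K)], ![(0 : K), (0 : K), (0 : K), (1 : K)], ![(0 : K), (0 : K), (0 : K), (0 : K)], ![(0 : K), (1 : K), (0 : K), (0 : K)]], ![![(0 : K), (0 : K), (0 : K), (1 : K)], ![(0 : K), (0 : K), (0 : K), (0 : K)], ![(0 : K), (0 : K), (0 : K), (0 : K)], ![(-1 : K), (0 : K), (0 : K), (0 : K)]], ![![(0 : K), (0 : K), (0 : K), (0 : K)], ![(0 : K), (0 : K), (0 : K), (0 : K)],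 ![(0 : K), (0 : K), (0 : K), (0 : K)], ![(0 : K), (0 : K), (0 : K), (0 : K)]], ![![(0 : K), (-1 : K), (0 : K), (0 : K)], ![(-1 : K), (0 : K), (0 : K), (0 : K)], ![(0 : K), (0 : K), (0 : K), (0 : K)], ![(0 : K), (0 : K), (0 : K), (0 : K)]]], ![![![(0 : K), (0 : K), (0 : K), (0 : K)], ![(0 : K), (0 : K), (1 : K), (0 : K)], ![(0 : K), (-1 : K), (0 : K), (0 : K)], ![(0 : K), (0 : K), (0 : K), (0 : K)]], ![![(0 : K), (0 : K), (1 : K), (0 : K)], ![(0 : K), (0 : K), (0 : K), (0 : K)], ![(1 : K), (0 : K), (0 : K), (0 : K)], ![(0 : K), (0 : K), (0 : K), (0 : K)]], ![![(0 : K), (-1 : K), (0 : K), (0 : K)], ![(-1 : K), (0 : K), (0 : K), (0 : K)], ![(0 : K), (0 : K), (0 : K), (0 : K)], ![(0 : K), (0 : K), (0 : K), (0 : K)]], ![![(0 : K), (0 : K), (0 : K), (0 : K)], ![(0 : K), (0 : K), (0 : K), (0 : K)], ![(0 : K), (0 : K), (0 : K), (0 : K)], ![(0 : K), (0 : K), (0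 : K), (0 : K)]]]] : Fin 4 → Fin 4 → Fin 4 → Fin 4 → K) b k b' k') → False) : False := by
  -- a line exit for a pure design `(c₁, t₁)` on `ι` is contradictory (rescale, translate, apply `Hσ`)
  have line_case : ∀ (c₁ : ι → K) (t₁ : ι → (((Fin 4 → K) × (Fin 4 → K)) →ₗ[K] ((Fin 4 → K) × (Fin 4 → K)) →ₗ[K] K)),
      (∀ a b y₂ y₃ : Fin 4 → K,
        ∑ r, c₁ r * (t₁ r (a, b) (y₂, y₃)) ^ 2 = (Matrix.of ![a, b, y₂, y₃]).permanent) →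
      (∀ k : Fin 4, (∀ (a : Fin 4 → K) r, t₁ r (a, 0) (Pi.single k 1, 0) = 0) ∧
        (∀ (b : Fin 4 → K) r, t₁ r (0, b) (0, Pi.single k 1) = 0)) →
      ∀ (τ : K), τ ≠ 0 → ∀ M : Matrix (Fin 6) (Fin 6) K,
      (M = !![0, 0, 0, 0, 0, 1; 0, 0, 0, 0, 1, 0; 0, 0, 0, 1, 0, 0; 0, 0, 1, 0, 0, 0; 0, 1, 0, 0, 0, 0;
          1, 0, 0, 0, 0, 0] ∨
       M = !![0, 0, 0, 0, 0, 1; 0, 0, 0, 0, 1, 0; 0, 0, 0, -1, 0, 0; 0, 0, -1, 0, 0, 0; 0, 1, 0, 0, 0, 0;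
          1, 0, 0, 0, 0, 0] ∨
       M = !![0, 0, 0, 0, 0, 1; 0, 0, 0, 0, -1, 0; 0, 0, 0, -1, 0, 0; 0, 0, -1, 0, 0, 0; 0, -1, 0, 0, 0, 0;
          1, 0, 0, 0, 0, 0]) →
      (∀ b k b' k' : Fin 4, ∑ r, c₁ r * t₁ r (0, Pi.single b 1) (Pi.single k 1, 0) *
          t₁ r (0, Pi.single b' 1) (Pi.single k' 1, 0) =
        τ * ((![![(0 : K), 1, 1, 1], ![-1, 0, 1, 1], ![-1, -1, 0, 1], ![-1, -1, -1, 0]] b b') *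
          (![![(0 : K), 1, 1, 1], ![-1, 0, 1, 1], ![-1, -1, 0, 1], ![-1, -1, -1, 0]] k k') *
          M (![![(0 : Fin 6), 0, 1, 2], ![0, 0, 3, 4], ![1, 3, 0, 5], ![2, 4, 5, 0]] b b')
            (![![(0 : Fin 6), 0, 1, 2], ![0, 0, 3, 4], ![1, 3, 0, 5], ![2, 4, 5, 0]] k k'))) → False := by
    intro c₁ t₁ hJ₁ hX₁ τ hτ M hM hG
    obtain ⟨c', t', hJ', hX', hn', hc'⟩ := rescale_pure c₁ t₁ hJ₁ hX₁ τ hτ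
    have hG' : ∀ b k b' k' : Fin 4, ∑ r, c' r * t' r (0, Pi.single b 1) (Pi.single k 1, 0) *
        t' r (0, Pi.single b' 1) (Pi.single k' 1, 0) =
        (![![(0 : K), 1, 1, 1], ![-1, 0, 1, 1], ![-1, -1, 0, 1], ![-1, -1, -1, 0]] b b') *
          (![![(0 : K), 1, 1, 1], ![-1, 0, 1, 1], ![-1, -1, 0, 1], ![-1, -1, -1, 0]] k k') *
          M (![![(0 : Fin 6), 0, 1, 2], ![0, 0, 3, 4], ![1, 3, 0, 5], ![2, 4, 5, 0]] b b')
            (![![(0 : Fin 6), 0, 1, 2], ![0, 0, 3, 4], ![1, 3, 0, 5], ![2, 4, 5, 0]] k k') := by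
      intro b k b' k'
      have hs : ∑ r, c' r * t' r (0, Pi.single b 1) (Pi.single k 1, 0) *
          t' r (0, Pi.single b' 1) (Pi.single k' 1, 0) =
          τ⁻¹ * ∑ r, c₁ r * t₁ r (0, Pi.single b 1) (Pi.single k 1, 0) *
            t₁ r (0, Pi.single b' 1) (Pi.single k' 1, 0) := by
        rw [Finset.mul_sum]
        refine Finset.sum_congr rfl fun r _ => ?_
        rw [hc', hn', hn']
        ring
      rw [hs, hG, ← mul_assoc, inv_mul_cancel₀ hτ, one_mul]
    rcases hM with rfl | rfl | rfl
    · exact Hppp c' t' hJ' hX' fun b k b' k' => by rw [hG', bridge_ppp]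
    · exact Hppm c' t' hJ' hX' fun b k b' k' => by rw [hG', bridge_ppm]
    · exact Hpmm c' t' hJ' hX' fun b k b' k' => by rw [hG', bridge_pmm]
  -- the transposed design (for the `μ`-side exits)
  let sw : ((Fin 4 → K) × (Fin 4 → K)) →ₗ[K] ((Fin 4 → K) × (Fin 4 → K)) :=
    { toFun := fun u => (u.2, u.1)
      map_add' := fun u v => rfl
      map_smul' := fun s u => rfl }
  let ts : ι → (((Fin 4 → K) × (Fin 4 → K)) →ₗ[K] ((Fin 4 → K) × (Fin 4 → K)) →ₗ[K] K) := fun r => ((t r).comp sw).compl₂ sw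
  have hts : ∀ r (a b y₂ y₃ : Fin 4 → K), ts r (a, b) (y₂, y₃) = t r (b, a) (y₃, y₂) :=
    fun r a b y₂ y₃ => rfl
  have hJs : (∀ a b y₂ y₃ : Fin 4 → K,
        ∑ r, c r * (ts r (a, b) (y₂, y₃)) ^ 2 = (Matrix.of ![a, b, y₂, y₃]).permanent) := by
    intro a b y₂ y₃
    simp_rw [hts]
    rw [hJ b a y₃ y₂, per_swap_row₀₁, per_swap_row₂₃]
  have hXs : (∀ k : Fin 4, (∀ (a : Fin 4 → K) r, ts r (a, 0) (Pi.single k 1, 0) = 0) ∧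
        (∀ (b : Fin 4 → K) r, ts r (0, b) (0, Pi.single k 1) = 0)) :=
    fun k => ⟨fun a r => by rw [hts]; exact (hX k).2 a r, fun b r => by rw [hts]; exact (hX k).1 b r⟩
  rcases nu_side_trichotomy c t hJ with ⟨ξ, hξ, g, hdetg⟩ | h0 | ⟨τ, hτ, M, hM, hG⟩
  · rcases mu_side_trichotomy c t hJ with ⟨η, hη, h, hdeth⟩ | h0' | ⟨τ, hτ, M, hM, hG⟩
    · exact false_of_allX_of_kernel_three_three c t hι hJ hX ξ η hξ hη g h hdetg hdeth
    · refine false_of_allX_of_nGram_zero c ts hι hJs hXs fun b k b' k' => ?_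
      simp only [hts]
      exact h0' b k b' k'
    · refine line_case c ts hJs hXs τ hτ M hM fun b k b' k' => ?_
      simp only [hts]
      exact hG b k b' k'
  · exact false_of_allX_of_nGram_zero c t hι hJ hX h0
  · exact line_case c t hJ hX τ hτ M hM hG

end Summit.ValiantsHypothesis.ValiantsHypothesis.Theorems.SymPencilPerFourInnerRankPureGramNuAssembly

end
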